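import Literature.MathematicalPhysics.QuantumFieldTheory.Balaban1983to89.B13Contraction113
import Literature.MathematicalPhysics.QuantumFieldTheory.Balaban1983to89.T3ContinuumYM3Torus
import HarnessLib

/-!
# Route `UnitScaleTilt`, crux K1 child «MinimiserStabilityRegPr» (stmt-QuantumFields-19200), leaf V2′ `stub_halvingStep` — PILLAR F4, PART 2
# (OWNER RULING g20-№8 §A3 «chart change of variables A = A′ − HD(A′)»): **[Balaban1985Variational] PROPOSITION 3 (SECT. C, (47)–(62))
# AT BACKGROUND 1, TYPED AND PROVED AT THE d = 3 CARRIER** — the linearizing chart `A = A′ − HD(A′)` of the k-fold averaging constraint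
# in the sup norms on bond fields of the fine torus `PBond (F.P K) 0` (fine) and `PBond (F.P K) (K − n)` (coarse), over ABSTRACT data:
# the nonlinear remainder `C` of the constraint map (`Q(A) = Q_lin A + C(A)`, [Balaban1985Averaging] Prop. 4 shape: `|C(Y)| ≤ C₂‖Y‖²`,
# holomorphic — the PORT / pillar C_k supplies it for the family's (0.4) descent) and a right inverse `H` of `Q_lin` with the sup bound
# `B₀` ((45)–(46); pillar F3 `…Prop8FlatMinimizerH`)

Cell `ym3-torus` (HUMAN RULING D-0037, YM ladder rung R3), seat `ym-ust-19200-f4` gen 0.  `--supports stmt-QuantumFields-19200 --as helper`;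
count-neutral; companion of `Theorems/UnitScaleTiltProp8FlatSmallSolution158.lean` (Prop. 6 for (158)).

THE PRINT ([Balaban1985Variational], CMP **102** (1985); journal page = PDF page + 276).  p. 285: *«The Proposition 4 of [4] implies
Q_j(ηA) = L^jηQ_jA + C_j(L^jηA), |C_j(L^jηA)| ≤ C₂(L^jη)²|A|². (44) … L^jηQ_jHB = B on Λ_j, RD*HB = 0, (45) … |HB| ≤ B₀(L^jη)⁻¹|B|,
|∇HB| ≤ B₀(L^jη)⁻²|B| on Ω_j. (46) We will construct the linearizing transformation in the form A = A′ − HD(A′), (47) … Q_j(ηA′ − ηHD(A′))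
= … = L^jηQ_jA′ on Λ_j, (48) or C_j(L^jηA′ − L^jηHD(A′)) = D(A′) on Λ_j. (49) Thus the function D(A′) is a fixed point of the transformation
X → C_j(L^jηA′ − L^jηHX) (50)»*; p. 286: *«Hence the transformation is contractive if 9C₂B₀ε₃ < 1 … there exists exactly one fixed point of the
transformation (50) … |D(A′)| ≤ … ≤ 4C₂|A′|²₍₋₁₎. (55) … |A| ≤ |A′| + B₀(L^jη)⁻¹4C₂|A′|²₍₋₁₎ (57)»*; p. 287: *«|∇A| ≤ |∇A′| + B₀(L^jη)⁻²4C₂|A′|²₍₋₁₎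
(58) … To solve the equation A′ − HD(A′) = A (59) for a given A, we take A′ = A + HX … D(A + HX) = X. (60)»*; p. 289 Prop. 3: *«The transformation
(47) satisfying the identity (48), i.e. linearizing the averaging operation Q(ηA), is defined and analytic for A′ satisfying (43) with ε₃
sufficiently small … The range of this transformation contains the set (43) with ε₂ ≤ ¼ε₃ … The function D(A′) satisfies the bound (55)»*.
Sect. F p. 302 uses exactly this at background 1: *«Now we proceed as in the previous sections, i.e. we make the change of variables
A = A′ − HD(A′)»*.

AT THE CARRIER (one level, top scale `j = k = K − n`, `L^kη = 1`): `|A′|₍₋₁₎ = sup_b ‖A′(b)‖` (Mathlib's sup norm of `PBond P 0 → V`), the block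
fields `X`, `D(A′)`, `B` live on `PBond P k → V` with `sup_c ‖X(c)‖`; every statement is POINTWISE (`∀ b, ‖· b‖ ≤ r`), the letters of pillar F3.

WHAT IS PROVED (sorry-free; no definition; axioms standard), for EVERY `P : Params`, level `k`, finite-dimensional complex fibre `V`:
* §1 **`chart47`** — PROPOSITION 3'S CORE: for `C` with `|C(Y)| ≤ C₂r²` whenever `|Y| ≤ r < R` (pointwise) and `DifferentiableOn ℂ C` on the sup-ball
  of radius `R`, `H` linear with `|HX| ≤ B₀β` for `|X| ≤ β`, and `9C₂B₀ε < 1`, `3ε ≤ R` (print: *«9C₂B₀ε₃ < 1»*, (43)'s radius): every `A′`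
  with `|A′| < ε` has EXACTLY ONE `D` with `|D| ≤ 4C₂ε²` and `C(A′ − HD) = D` ((49)–(50)), it obeys (55) `|D| ≤ 4C₂ρ²` for every pointwise
  bound `ρ` of `A′`, and (48): `Q_lin(A′ − HD) + C(A′ − HD) = Q_lin A′` for every linear `Q_lin` with `Q_lin ∘ H = id` — i.e. the FULL constraint
  map `Q = Q_lin + C` is LINEARIZED by `A = A′ − HD(A′)`.  Mechanism: lit-balaban's `B13Contraction113.exists_unique_fixedPoint` / `bound_114`
  ((50)–(55) with the Cauchy-formula Lipschitz bound (53)–(54)) BY NAME at `𝒴 := PBond P 0 → V`, `𝒳 := PBond P k → V` (sup norms).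
* §2 `size_chart47_le` ((57)), `grad_chart47_le` ((58), with `H`'s gradient letter `c·|(HX)(⟨s+e_ν,μ⟩) − (HX)(⟨s,μ⟩)| ≤ B₁β`),
  `chart47_left_inv` (`A′ = A + HC(A)` for `A := A′ − HD(A′)`: (49) read backwards), **`chart47_range`** ((59)–(62): for `|A| < δ` with
  `δ + B₀C₂δ² ≤ ε`, `δ ≤ R`… the configuration `A′ := A + HC(A)` lies in the domain, its `D` is `C(A)`, and `A′ − HD(A′) = A` — the range
  statement with the EXPLICIT preimage, as lit-balaban's `B11Prop3Concrete` (ii)).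
* §3 `chart47_T3` — §1 at the d = 3 carrier (`P := F.P K`, coarse level `K − n`), every member `F`, all heights.
HONEST SCOPE.  (i) `C`, `H`, `Q_lin` are ABSTRACT with their printed bounds as hypotheses: nothing of [Balaban1985Averaging] Props 4–5 (the
true `C₂`, analyticity of the family's k-fold (0.4) descent in the flat chart — pillar C_k / PORT of CENSUS-19200-V2-g4) or of (45)–(46)
(pillar F3) is proved here; (ii) (73) (decay of `δD/δA′`) and the analyticity of `D` in `A′` are NOT re-read (abstractly available:
`B13Contraction113.analytic_fixedPoint_113`, `B11Prop3Model.norm_fderiv_Dfix_le`); (iii) ONE level; (iv) NOT a claim about the mass gap.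

References: T. Bałaban, CMP **102** (1985) 277–309 [Balaban1985Variational] (44)–(62) pp.285–287, Prop. 3 p.289, Sect. F p.302;
CMP **98** (1985) 17–51 [Balaban1985Averaging] Props. 4–5 pp.38–42.
-/

set_option autoImplicit false

noncomputable section

open Metric Set

namespace Summit.QuantumFields.YangMills.Theorems.FlatChart47

open Literature.MathematicalPhysics.QuantumFieldTheory.Balaban1983to89
open Literature.MathematicalPhysics.QuantumFieldTheory.Balaban1983to89.B13Contraction113
  (QuadAnalytic exists_unique_fixedPoint bound_114)

section Generic

variable {P : Params} {k : ℕ} {V : Type*} [NormedAddCommGroup V] [NormedSpace ℂ V]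

/-! ## §1 Proposition 3's core: the fixed point `D(A′)` of (50), the bound (55), the linearization (48) -/

/-- **[Balaban1985Variational] PROPOSITION 3 AT BACKGROUND 1, AT THE LATTICE `PBond P 0` (fine) / `PBond P k` (coarse), SUP NORMS.**
Data: the nonlinear remainder `C` of the constraint map with `|C(Y)| ≤ C₂r²` for `|Y| ≤ r < R` pointwise and `DifferentiableOn ℂ C` on the
sup-ball of radius `R` ((44): *«|C_j(L^jηA)| ≤ C₂(L^jη)²|A|²»*, [4] Prop. 4 «analytic»); `H` ℂ-linear with `|HX| ≤ B₀β` for `|X| ≤ β` ((46));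
`9C₂B₀ε < 1` and `3ε ≤ R` (p. 286 *«the transformation is contractive if 9C₂B₀ε₃ < 1»*).  For every `A′` with `|A′(b)| < ε` at every bond:
(i) there is EXACTLY ONE block field `D` with `|D(c)| ≤ 4C₂ε²` everywhere and `C(A′ − HD) = D` — *«(49) … D(A′) is a fixed point of the
transformation X → C_j(L^jηA′ − L^jηHX) (50)»*; (ii) (55) `|D(c)| ≤ 4C₂ρ²` for every pointwise bound `ρ ≥ 0` of `A′`; (iii) (48): for every
ℂ-linear `Q_lin` with `Q_lin(HX) = X` ((45)), `Q_lin(A′ − HD) + C(A′ − HD) = Q_lin A′` — the full constraint `Q = Q_lin + C` evaluated at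
`A = A′ − HD(A′)` is the LINEAR `Q_lin A′`.  Proof: lit-balaban `B13Contraction113.exists_unique_fixedPoint` + `bound_114` at the sup-normed
spaces `PBond P 0 → V`, `PBond P k → V`. [cite: Balaban1985Variational, (47)-(50) p.285, (55) p.286, Prop. 3 p.289] -/
theorem chart47 [FiniteDimensional ℂ V] (C : (PBond P 0 → V) → (PBond P k → V))
    (H : (PBond P k → V) →ₗ[ℂ] (PBond P 0 → V)) {C₂ R B₀ ε : ℝ} (hC₂ : 0 ≤ C₂) (hB₀ : 0 ≤ B₀)
    (hH : ∀ (X : PBond P k → V) (β : ℝ), (∀ c, ‖X c‖ ≤ β) → ∀ b, ‖H X b‖ ≤ B₀ * β)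
    (hCq : ∀ (Y : PBond P 0 → V) (r : ℝ), r < R → (∀ b, ‖Y b‖ ≤ r) → ∀ c, ‖C Y c‖ ≤ C₂ * r ^ 2)
    (hCd : DifferentiableOn ℂ C {Y : PBond P 0 → V | ∀ b, ‖Y b‖ < R})
    (hq : 9 * C₂ * B₀ * ε < 1) (hR : 3 * ε ≤ R) (A' : PBond P 0 → V) (hA' : ∀ b, ‖A' b‖ < ε) :
    ∃ D : PBond P k → V,
      ((∀ c, ‖D c‖ ≤ 4 * C₂ * ε ^ 2) ∧ C (A' - H D) = D) ∧
      (∀ D' : PBond P k → V, (∀ c, ‖D' c‖ ≤ 4 * C₂ * ε ^ 2) → C (A' - H D') = D' → D' = D) ∧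
      (∀ ρ : ℝ, 0 ≤ ρ → (∀ b, ‖A' b‖ ≤ ρ) → ∀ c, ‖D c‖ ≤ 4 * C₂ * ρ ^ 2) ∧
      ∀ (Qlin : (PBond P 0 → V) →ₗ[ℂ] (PBond P k → V)), (∀ X, Qlin (H X) = X) →
        Qlin (A' - H D) + C (A' - H D) = Qlin A' := by
  haveI : CompleteSpace V := FiniteDimensional.complete ℂ V
  -- 0 < ε (the fine lattice is nonempty)
  have hε : 0 < ε := (norm_nonneg _).trans_lt (hA' ⟨default, ⟨0, P.hd⟩⟩)
  have hρ0 : 0 ≤ 4 * C₂ * ε ^ 2 := by positivity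
  -- the letters read in the sup norms
  have hA'n : ‖A'‖ < ε := (pi_norm_lt_iff hε).2 hA'
  have hHop : ∀ X : PBond P k → V, ‖H X‖ ≤ B₀ * ‖X‖ := fun X =>
    (pi_norm_le_iff_of_nonneg (mul_nonneg hB₀ (norm_nonneg _))).2 (hH X ‖X‖ (fun c => norm_le_pi_norm X c))
  have hC : QuadAnalytic C C₂ R := by
    refine ⟨fun Y hY => ?_, fun Pt Q => ?_⟩
    · exact (pi_norm_le_iff_of_nonneg (mul_nonneg hC₂ (sq_nonneg _))).2
        (hCq Y ‖Y‖ hY (fun b => norm_le_pi_norm Y b))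
    · have hline : Differentiable ℂ (fun ζ : ℂ => Pt + ζ • Q) :=
        (differentiable_const _).add (differentiable_id.smul_const _)
      refine hCd.comp hline.differentiableOn fun ζ hζ b => ?_
      exact (norm_le_pi_norm (Pt + ζ • Q) b).trans_lt hζ
  obtain ⟨D, hDball, hDfix, hDuniq⟩ := exists_unique_fixedPoint hC hC₂ hB₀ hHop hA'n hq hR
  have hball : ∀ X : PBond P k → V, X ∈ closedBall (0 : PBond P k → V) (4 * C₂ * ε ^ 2) ↔ ∀ c, ‖X c‖ ≤ 4 * C₂ * ε ^ 2 := by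
    intro X; rw [mem_closedBall_zero_iff, pi_norm_le_iff_of_nonneg hρ0]
  refine ⟨D, ⟨(hball D).1 hDball, hDfix⟩, fun D' hD' hfix' => hDuniq D' ((hball D').2 hD') hfix', fun ρ hρ hA'ρ c => ?_,
    fun Qlin hQH => ?_⟩
  · -- (55)
    have h55 : ‖D‖ ≤ 4 * C₂ * ‖A'‖ ^ 2 := bound_114 hC hC₂ hB₀ hHop hA'n hq hR hDball hDfix
    have hA'le : ‖A'‖ ≤ ρ := (pi_norm_le_iff_of_nonneg hρ).2 hA'ρ
    calc ‖D c‖ ≤ ‖D‖ := norm_le_pi_norm D c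
      _ ≤ 4 * C₂ * ‖A'‖ ^ 2 := h55
      _ ≤ 4 * C₂ * ρ ^ 2 := mul_le_mul_of_nonneg_left (pow_le_pow_left₀ (norm_nonneg _) hA'le 2) (by positivity)
  · -- (48)
    rw [map_sub, hQH, hDfix, sub_add_cancel]

/-! ## §2 The sizes (57)–(58), the left inverse, and the range (59)–(62) -/

omit [NormedSpace ℂ V] in
/-- **(57) at background 1**: *«|A| ≤ |A′| + B₀(L^jη)⁻¹4C₂|A′|²₍₋₁₎»* — for `A = A′ − HD` with `|D(c)| ≤ 4C₂ρ²` ((55)), `|A′(b)| ≤ ρ` and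
`|HX| ≤ B₀β` for `|X| ≤ β`: `|A(b)| ≤ ρ + B₀·4C₂ρ²` at every bond. [cite: Balaban1985Variational, (57) p.286] -/
theorem size_chart47_le [NormedSpace ℂ V] (H : (PBond P k → V) →ₗ[ℂ] (PBond P 0 → V)) {C₂ B₀ ρ : ℝ}
    (hH : ∀ (X : PBond P k → V) (β : ℝ), (∀ c, ‖X c‖ ≤ β) → ∀ b, ‖H X b‖ ≤ B₀ * β)
    {A' : PBond P 0 → V} {D : PBond P k → V} (hA' : ∀ b, ‖A' b‖ ≤ ρ) (hD : ∀ c, ‖D c‖ ≤ 4 * C₂ * ρ ^ 2) :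
    ∀ b, ‖(A' - H D) b‖ ≤ ρ + B₀ * (4 * C₂ * ρ ^ 2) := fun b =>
  (norm_sub_le _ _).trans (add_le_add (hA' b) (hH D _ hD b))

omit [NormedSpace ℂ V] in
/-- **(58) at background 1**: *«If we assume also |∇A′| < ε₃(L^jη)⁻², then |∇A| ≤ |∇A′| + B₀(L^jη)⁻²4C₂|A′|²₍₋₁₎ (58)»* — with `H`'s
gradient letter `c·|(HX)(⟨s+e_ν,μ⟩) − (HX)(⟨s,μ⟩)| ≤ B₁β` for `|X| ≤ β` (pillar F3 `FlatMinimizerH.exists_flatH_T3`, `c = L^{K−n}`),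
`|D(c)| ≤ 4C₂ρ²` and a gradient bound `ρ′` of `A′`: `c·|A(⟨s+e_ν,μ⟩) − A(⟨s,μ⟩)| ≤ ρ′ + B₁·4C₂ρ²` for `A = A′ − HD`.
[cite: Balaban1985Variational, (58) p.287] -/
theorem grad_chart47_le [NormedSpace ℂ V] (H : (PBond P k → V) →ₗ[ℂ] (PBond P 0 → V)) {c C₂ B₁ ρ ρ' : ℝ} (hc : 0 ≤ c)
    (hH' : ∀ (X : PBond P k → V) (β : ℝ), (∀ c', ‖X c'‖ ≤ β) →
      ∀ (s : Site P 0) (μ ν : Fin P.d), c * ‖H X ⟨s.shift ν, μ⟩ - H X ⟨s, μ⟩‖ ≤ B₁ * β)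
    {A' : PBond P 0 → V} {D : PBond P k → V}
    (hA' : ∀ (s : Site P 0) (μ ν : Fin P.d), c * ‖A' ⟨s.shift ν, μ⟩ - A' ⟨s, μ⟩‖ ≤ ρ')
    (hD : ∀ c', ‖D c'‖ ≤ 4 * C₂ * ρ ^ 2) :
    ∀ (s : Site P 0) (μ ν : Fin P.d),
      c * ‖(A' - H D) ⟨s.shift ν, μ⟩ - (A' - H D) ⟨s, μ⟩‖ ≤ ρ' + B₁ * (4 * C₂ * ρ ^ 2) := by
  intro s μ ν
  have e : (A' - H D) ⟨s.shift ν, μ⟩ - (A' - H D) ⟨s, μ⟩ =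
      (A' ⟨s.shift ν, μ⟩ - A' ⟨s, μ⟩) - (H D ⟨s.shift ν, μ⟩ - H D ⟨s, μ⟩) := by
    simp only [Pi.sub_apply]; abel
  rw [e]
  calc c * ‖(A' ⟨s.shift ν, μ⟩ - A' ⟨s, μ⟩) - (H D ⟨s.shift ν, μ⟩ - H D ⟨s, μ⟩)‖
      ≤ c * (‖A' ⟨s.shift ν, μ⟩ - A' ⟨s, μ⟩‖ + ‖H D ⟨s.shift ν, μ⟩ - H D ⟨s, μ⟩‖) :=
        mul_le_mul_of_nonneg_left (norm_sub_le _ _) hc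
    _ = c * ‖A' ⟨s.shift ν, μ⟩ - A' ⟨s, μ⟩‖ + c * ‖H D ⟨s.shift ν, μ⟩ - H D ⟨s, μ⟩‖ := mul_add _ _ _
    _ ≤ ρ' + B₁ * (4 * C₂ * ρ ^ 2) := add_le_add (hA' s μ ν) (hH' D _ hD s μ ν)

omit [NormedSpace ℂ V] in
/-- **The chart is injective with explicit left inverse**: (49) read backwards — if `C(A′ − HD) = D` then `A′ = A + HC(A)` for `A := A′ − HD`
(p. 287: *«we take A′ = A + HX … D(A + HX) = X (60)»*). [cite: Balaban1985Variational, (59)-(60) p.287] -/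
theorem chart47_left_inv [NormedSpace ℂ V] (C : (PBond P 0 → V) → (PBond P k → V)) (H : (PBond P k → V) →ₗ[ℂ] (PBond P 0 → V))
    {A' : PBond P 0 → V} {D : PBond P k → V} (hfix : C (A' - H D) = D) :
    A' = (A' - H D) + H (C (A' - H D)) := by
  rw [hfix, sub_add_cancel]

/-- **(59)–(62), THE RANGE OF THE CHART, with the explicit preimage**: under the data of `chart47`, for `A` with `|A(b)| < δ` everywhere,
`δ ≤ ε` and `δ + B₀C₂δ² ≤ ε` (print: *«for ε₂ ≤ ¼ε₃ there exists exactly one solution of Eq. (59)»*), the configuration `A′ := A + HC(A)`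
lies in the domain (`|A′(b)| < ε`), its `D` (the unique fixed point of (50) in the ball `4C₂ε²`) IS `C(A)`, and `A′ − HD(A′) = A`: the
equation *«A′ − HD(A′) = A (59)»* is solved. [cite: Balaban1985Variational, (59)-(62) p.287, Prop. 3 p.289] -/
theorem chart47_range [FiniteDimensional ℂ V] (C : (PBond P 0 → V) → (PBond P k → V))
    (H : (PBond P k → V) →ₗ[ℂ] (PBond P 0 → V)) {C₂ R B₀ ε δ : ℝ} (hC₂ : 0 ≤ C₂) (hB₀ : 0 ≤ B₀)
    (hH : ∀ (X : PBond P k → V) (β : ℝ), (∀ c, ‖X c‖ ≤ β) → ∀ b, ‖H X b‖ ≤ B₀ * β)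
    (hCq : ∀ (Y : PBond P 0 → V) (r : ℝ), r < R → (∀ b, ‖Y b‖ ≤ r) → ∀ c, ‖C Y c‖ ≤ C₂ * r ^ 2)
    (hCd : DifferentiableOn ℂ C {Y : PBond P 0 → V | ∀ b, ‖Y b‖ < R})
    (hq : 9 * C₂ * B₀ * ε < 1) (hR : 3 * ε ≤ R) (hδε : δ ≤ ε) (hδ : δ + B₀ * (C₂ * δ ^ 2) ≤ ε)
    (A : PBond P 0 → V) (hA : ∀ b, ‖A b‖ < δ) :
    (∀ b, ‖(A + H (C A)) b‖ < ε) ∧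
      (∀ c, ‖C A c‖ ≤ 4 * C₂ * ε ^ 2) ∧ C ((A + H (C A)) - H (C A)) = C A ∧
      (∀ D' : PBond P k → V, (∀ c, ‖D' c‖ ≤ 4 * C₂ * ε ^ 2) → C ((A + H (C A)) - H D') = D' → D' = C A) ∧
      (A + H (C A)) - H (C A) = A := by
  haveI : CompleteSpace V := FiniteDimensional.complete ℂ V
  have hδ0 : 0 < δ := (norm_nonneg _).trans_lt (hA ⟨default, ⟨0, P.hd⟩⟩)
  have hε : 0 < ε := hδ0.trans_le hδε
  -- |A| < δ in the sup norm, |C A| ≤ C₂|A|² < C₂δ², |HC(A)| ≤ B₀C₂|A|²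
  have hAn : ‖A‖ < δ := (pi_norm_lt_iff hδ0).2 hA
  have hδR : δ < R := by linarith
  have hCA : ∀ c, ‖C A c‖ ≤ C₂ * ‖A‖ ^ 2 := hCq A ‖A‖ (hAn.trans hδR) (fun b => norm_le_pi_norm A b)
  have hsq : ‖A‖ ^ 2 < δ ^ 2 := by
    have := hAn; nlinarith [norm_nonneg A]
  have hA'lt : ∀ b, ‖(A + H (C A)) b‖ < ε := by
    intro b
    have h1 : ‖H (C A) b‖ ≤ B₀ * (C₂ * ‖A‖ ^ 2) := hH (C A) _ hCA b
    have h2 : B₀ * (C₂ * ‖A‖ ^ 2) ≤ B₀ * (C₂ * δ ^ 2) :=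
      mul_le_mul_of_nonneg_left (mul_le_mul_of_nonneg_left hsq.le hC₂) hB₀
    calc ‖(A + H (C A)) b‖ ≤ ‖A b‖ + ‖H (C A) b‖ := norm_add_le _ _
      _ < δ + B₀ * (C₂ * δ ^ 2) := add_lt_add_of_lt_of_le (hA b) (h1.trans h2)
      _ ≤ ε := hδ
  have hCAball : ∀ c, ‖C A c‖ ≤ 4 * C₂ * ε ^ 2 := by
    intro c
    refine (hCA c).trans ?_
    have h3 : ‖A‖ ^ 2 ≤ ε ^ 2 := hsq.le.trans (pow_le_pow_left₀ hδ0.le hδε 2)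
    nlinarith [sq_nonneg ε]
  have hcancel : (A + H (C A)) - H (C A) = A := add_sub_cancel_right _ _
  obtain ⟨D, ⟨hDb, hDfix⟩, hDuniq, -, -⟩ := chart47 C H hC₂ hB₀ hH hCq hCd hq hR (A + H (C A)) hA'lt
  have hfixCA : C ((A + H (C A)) - H (C A)) = C A := by rw [hcancel]
  have hDCA : C A = D := hDuniq (C A) hCAball hfixCA
  refine ⟨hA'lt, hCAball, hfixCA, fun D' hD' hfix' => ?_, hcancel⟩
  rw [hDuniq D' hD' hfix', ← hDCA]

end Generic

/-! ## §3 At the d = 3 carrier of `T3Thm1Carrier.varProblem3 F n K` (fine torus `PBond (F.P K) 0`, block fields on level `K − n`) -/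

section T3

open T3ContinuumYM3Torus (T3Family)

variable {V : Type*} [NormedAddCommGroup V] [NormedSpace ℂ V] [FiniteDimensional ℂ V]

/-- **PILLAR F4 (CHART) AT THE d = 3 CARRIER** — Proposition 3's core for the k-fold constraint of run `K` over the comparison height `n`
(fine bonds `PBond (F.P K) 0`, block fields on `PBond (F.P K) (K − n)`, values in the complexified Lie algebra `V`): for the nonlinear
remainder `C` of the constraint map (pillar C_k: the family's k-fold (0.4) descent read in the flat chart, `Q = Q_lin + C`) with the [4]
Prop. 4-type bound `C₂` and holomorphy on the sup-ball of radius `R`, a right inverse `H` of `Q_lin` with sup bound `B₀` (pillar F3),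
`9C₂B₀ε < 1`, `3ε ≤ R`: every `A′` with `|A′| < ε` has exactly one `D = D(A′)` in the ball `4C₂ε²` with `C(A′ − HD) = D`, (55) holds, and
`A = A′ − HD(A′)` LINEARIZES the constraint: `Q_lin A + C(A) = Q_lin A′`.  Uniform in `F`, `n`, `K`.
[cite: Balaban1985Variational, Prop. 3 p.289, (47)-(55) pp.285-286, Sect. F p.302] -/
theorem chart47_T3 (F : T3Family) (n K : ℕ) (C : (PBond (F.P K) 0 → V) → (PBond (F.P K) (K - n) → V))
    (H : (PBond (F.P K) (K - n) → V) →ₗ[ℂ] (PBond (F.P K) 0 → V)) {C₂ R B₀ ε : ℝ} (hC₂ : 0 ≤ C₂) (hB₀ : 0 ≤ B₀)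
    (hH : ∀ (X : PBond (F.P K) (K - n) → V) (β : ℝ), (∀ c, ‖X c‖ ≤ β) → ∀ b, ‖H X b‖ ≤ B₀ * β)
    (hCq : ∀ (Y : PBond (F.P K) 0 → V) (r : ℝ), r < R → (∀ b, ‖Y b‖ ≤ r) → ∀ c, ‖C Y c‖ ≤ C₂ * r ^ 2)
    (hCd : DifferentiableOn ℂ C {Y : PBond (F.P K) 0 → V | ∀ b, ‖Y b‖ < R})
    (hq : 9 * C₂ * B₀ * ε < 1) (hR : 3 * ε ≤ R) (A' : PBond (F.P K) 0 → V) (hA' : ∀ b, ‖A' b‖ < ε) :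
    ∃ D : PBond (F.P K) (K - n) → V,
      ((∀ c, ‖D c‖ ≤ 4 * C₂ * ε ^ 2) ∧ C (A' - H D) = D) ∧
      (∀ D' : PBond (F.P K) (K - n) → V, (∀ c, ‖D' c‖ ≤ 4 * C₂ * ε ^ 2) → C (A' - H D') = D' → D' = D) ∧
      (∀ ρ : ℝ, 0 ≤ ρ → (∀ b, ‖A' b‖ ≤ ρ) → ∀ c, ‖D c‖ ≤ 4 * C₂ * ρ ^ 2) ∧
      ∀ (Qlin : (PBond (F.P K) 0 → V) →ₗ[ℂ] (PBond (F.P K) (K - n) → V)), (∀ X, Qlin (H X) = X) →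
        Qlin (A' - H D) + C (A' - H D) = Qlin A' :=
  chart47 C H hC₂ hB₀ hH hCq hCd hq hR A' hA'

end T3

end Summit.QuantumFields.YangMills.Theorems.FlatChart47

end
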